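import Literature.MeasureTheory.Integral.AnalyticSubmersionSharpDensityFibreFlat

/-!
# «NOWHERE FIBRE-FLAT» FROM FIBRE-PRESERVING COORDINATE SECTIONS — the inhabitable replacement of transversality, and the flat-locus sharp engine
# read through it

Generic topology ∕ measure theory on finite-dimensional real spaces (no `def`, no named fact, no `sorry`).  Sequel to `AnalyticSubmersionSharpDensityFibreFlat`
(this seat): its corollary `…_sharp_of_nowhereFibreFlat` asks, per threshold `Γ i` and point `x`, «`Γ i (M x) x = 0 ⇒ ∃ᶠ x' → x` ON THE FIBRE `M⁻¹(M x)` with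
`Γ i (M x) x' ≠ 0`».  THIS FILE gives the criterion the record can meet: if the threshold depends on `x` only through a coordinate `P i x ∈ G i`
(`Γ i y x = γ i y (P i x)`) whose defining function `γ i y` has a zero set WITH EMPTY INTERIOR (e.g. real-analytic and not identically zero on a connected
coordinate space — [Mityagin2015] ∕ the identity theorem), and the fibre through `x` carries a continuous SECTION of that coordinate (`c : G i → E` with
`c (P i x) = x`, `M (c g) = M x` and `P i (c g) = g` for `g` near `P i x` — «the fibre projects onto a neighbourhood of the coordinate»), then no threshold is
fibre-flat at any point.  LOCATED CONSUMER (cell `pub-ymgap`, node N09, road B; width seat `pub-ymgap-dag-n09-w3` g5, `--supports` K1⁹ stmt-QuantumFields-27364,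
count-neutral): for the (2.9) cut-off of [Balaban1987RG1] at a non-distinguished bond `b` the coordinate is the bond variable `U(b)`, the defining function is the
operator-norm level function of this seat's `HaarDist1LevelHypersurface` (not identically zero on the connected `SU(N)`), and the section is the one-bond
re-adjustment of the central bonds (road A′'s local inverses, dag-n09-w4 g5 `exists_localInverse_oneBond` ∕ dag-n09-w6 g3's `ϑ`; `Ū(c′)` is blind to `β(c)` for `c′ ≠ c`)
— all DISPLAYED there, nothing of it constructed here.

WHAT IS PROVED (namespace `Literature.MeasureTheory.Integral.AnalyticSubmersion`).
* §1 `frequently_nhdsWithin_fibre_of_tendsto` (filter plumbing: a family tending to `x` inside the fibre transports `∃ᶠ` to `𝓝[M⁻¹{M x}] x`),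
  ★★ `nowhereFibreFlat_of_coordinateSections` (the criterion above, for a countable family of thresholds at once).
* §2 ★★ `exists_continuousOn_density_map_of_analytic_submersion_sharp_of_coordinateSections` — the flat-locus sharp engine with the PLAIN exemption
  `∀ i, Γ i (M x) x ≠ 0`, its «nowhere fibre-flat» side condition discharged by §1 (factorisation + empty-interior zero sets + sections on `O₀`).

HONEST SCOPE.  Pure bookkeeping (Mathlib `Filter.Tendsto.frequently`, `tendsto_nhdsWithin_iff`); the sections, the factorisation and the empty-interior
property are hypotheses; no claim about Bałaban's renormalization group, N09 or the Clay problem.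
-/

noncomputable section

namespace Literature.MeasureTheory.Integral.AnalyticSubmersion

open _root_.MeasureTheory _root_.MeasureTheory.Measure Set Function Filter Metric
open scoped ENNReal NNReal Topology

/-! ## §1 The criterion -/

section Criterion

variable {E Y : Type*} [TopologicalSpace E]

/-- **A family tending to `x` INSIDE the fibre `M⁻¹(M x)` transports «frequently» to the fibre neighbourhood filter** (filter bookkeeping for the fibres of
a submersion). [cite: EvansGariepy1992, §3.4.3 Thm 2 (C¹-submersion special case; bookkeeping on the fibres)] -/
theorem frequently_nhdsWithin_fibre_of_tendsto {S : Type*} {l : Filter S} {c : S → E} {M : E → Y} {x : E} {p : E → Prop}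
    (hc : Tendsto c l (𝓝 x)) (hM : ∀ᶠ s in l, M (c s) = M x) (hp : ∃ᶠ s in l, p (c s)) :
    ∃ᶠ x' in 𝓝[M ⁻¹' {M x}] x, p x' := by
  have hc' : Tendsto c l (𝓝[M ⁻¹' {M x}] x) :=
    tendsto_nhdsWithin_iff.2 ⟨hc, hM.mono fun s hs => by simpa only [mem_preimage, mem_singleton_iff] using hs⟩
  exact hc'.frequently hp

/-- ★★ **«NOWHERE FIBRE-FLAT» FROM COORDINATE SECTIONS.**  Thresholds factoring through coordinates, `Γ i y x = γ i y (P i x)`, whose defining functions `γ i y`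
have zero sets with EMPTY INTERIOR at the relevant points (`∃ᶠ g' → P i x, γ i (M x) g' ≠ 0` for `x ∈ O₀`), on a set `O₀` every point of which carries, for every `i`, a continuous fibre-preserving
SECTION of the coordinate `P i` through it: then on `O₀` no threshold vanishes identically along the fibre near any point — the side condition of
`exists_continuousOn_density_map_of_analytic_submersion_sharp_of_nowhereFibreFlat`.
[cite: Mityagin2015, Proposition 1 (the empty-interior zero sets it is applied with)] [cite: EvansGariepy1992, §3.4.3 Thm 2 (C¹-submersion special case; bookkeeping)] -/
theorem nowhereFibreFlat_of_coordinateSections {ι : Type*} {M : E → Y} {Γ : ι → Y → E → ℝ} {G : ι → Type*} [∀ i, TopologicalSpace (G i)]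
    (P : ∀ i, E → G i) (γ : ∀ i, Y → G i → ℝ) (hΓ : ∀ i y x, Γ i y x = γ i y (P i x))
    {O₀ : Set E} (hγ : ∀ x ∈ O₀, ∀ i, ∃ᶠ g' in 𝓝 (P i x), γ i (M x) g' ≠ 0)
    (hsec : ∀ x ∈ O₀, ∀ i, ∃ c : G i → E, Tendsto c (𝓝 (P i x)) (𝓝 x) ∧ ∀ᶠ g in 𝓝 (P i x), M (c g) = M x ∧ P i (c g) = g) :
    ∀ x ∈ O₀, ∀ i, Γ i (M x) x = 0 → ∃ᶠ x' in 𝓝[M ⁻¹' {M x}] x, Γ i (M x) x' ≠ 0 := by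
  intro x hx i _
  obtain ⟨c, hc, hcM⟩ := hsec x hx i
  refine frequently_nhdsWithin_fibre_of_tendsto hc (hcM.mono fun g hg => hg.1) ?_
  have h := (hγ x hx i).and_eventually hcM
  refine h.mono fun g hg => ?_
  rw [hΓ, hg.2.2]
  exact hg.1

end Criterion

/-! ## §2 The flat-locus sharp engine read through the criterion -/

variable {E Y : Type*}
  [NormedAddCommGroup E] [NormedSpace ℝ E] [FiniteDimensional ℝ E] [MeasurableSpace E] [BorelSpace E]
  [NormedAddCommGroup Y] [NormedSpace ℝ Y] [FiniteDimensional ℝ Y] [MeasurableSpace Y] [BorelSpace Y]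

omit [MeasurableSpace E] [BorelSpace E] [MeasurableSpace Y] [BorelSpace Y] in
/-- **THE COORDINATE IS OPEN ALONG THE FIBRE WHEN `(M, P)` IS A SUBMERSION AT `x`**: if `x ↦ (M x, P x)` has a strict derivative with range `⊤`, every
fibre-neighbourhood of `x` in `M⁻¹(M x)` is mapped by `P` onto a neighbourhood of `P x` (Mathlib `HasStrictFDerivAt.map_nhds_eq_of_surj` on the pair, then the slice
at `M x`). [cite: EvansGariepy1992, §3.4.3 Thm 2 (C¹-submersion special case: a submersion is open; bookkeeping on the fibres)] -/
theorem nhds_le_map_nhdsWithin_fibre_of_surj {G : Type*} [NormedAddCommGroup G] [NormedSpace ℝ G] [CompleteSpace G]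
    {M : E → Y} {P : E → G} {x : E} {M' : E →L[ℝ] Y} {P' : E →L[ℝ] G}
    (hM : HasStrictFDerivAt M M' x) (hP : HasStrictFDerivAt P P' x) (hsurj : (M'.prod P').range = ⊤) :
    𝓝 (P x) ≤ map P (𝓝[M ⁻¹' {M x}] x) := by
  haveI : CompleteSpace E := FiniteDimensional.complete ℝ E
  haveI : CompleteSpace Y := FiniteDimensional.complete ℝ Y
  have hmap : map (fun x' => (M x', P x')) (𝓝 x) = 𝓝 (M x, P x) := (hM.prodMk hP).map_nhds_eq_of_surj hsurj
  intro S hS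
  rw [mem_map, mem_nhdsWithin_iff_exists_mem_nhds_inter] at hS
  obtain ⟨N, hN, hNS⟩ := hS
  have hN' : (fun x' => (M x', P x')) '' N ∈ 𝓝 (M x, P x) := by rw [← hmap]; exact image_mem_map hN
  have hslice : {g | (M x, g) ∈ (fun x' => (M x', P x')) '' N} ∈ 𝓝 (P x) :=
    (Continuous.prodMk_right (M x)).continuousAt.preimage_mem_nhds hN'
  refine mem_of_superset hslice fun g hg => ?_
  obtain ⟨x', hx'N, hx'⟩ := hg
  have hMx' : M x' = M x := congrArg Prod.fst hx'
  have hPx' : P x' = g := congrArg Prod.snd hx'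
  have hx'S : x' ∈ P ⁻¹' S := hNS ⟨hx'N, by simpa only [mem_preimage, mem_singleton_iff] using hMx'⟩
  rw [← hPx']
  exact hx'S

omit [MeasurableSpace E] [BorelSpace E] [MeasurableSpace Y] [BorelSpace Y] in
/-- ★★ **«NOWHERE FIBRE-FLAT» FROM SUBMERSIVE COORDINATES** (no section to construct): thresholds factoring through coordinates with empty-interior zero sets, and
at every point of `O₀` the pair `(M, P i)` a submersion (strict derivatives with joint range `⊤` — at the record: the differential of the averaging restricted to the
CENTRAL-bond coordinates is onto, so any non-central coordinate can be prescribed inside the fibre) ⇒ no threshold is fibre-flat on `O₀`.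
[cite: EvansGariepy1992, §3.4.3 Thm 2 (C¹-submersion special case)] -/
theorem nowhereFibreFlat_of_submersiveCoordinates {ι : Type*} {M : E → Y} {Γ : ι → Y → E → ℝ} {G : ι → Type*}
    [∀ i, NormedAddCommGroup (G i)] [∀ i, NormedSpace ℝ (G i)] [∀ i, CompleteSpace (G i)]
    (P : ∀ i, E → G i) (γ : ∀ i, Y → G i → ℝ) (hΓ : ∀ i y x, Γ i y x = γ i y (P i x))
    {O₀ : Set E} (hγ : ∀ x ∈ O₀, ∀ i, ∃ᶠ g' in 𝓝 (P i x), γ i (M x) g' ≠ 0)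
    (hsub : ∀ x ∈ O₀, ∀ i, ∃ (M' : E →L[ℝ] Y) (P' : E →L[ℝ] G i),
      HasStrictFDerivAt M M' x ∧ HasStrictFDerivAt (P i) P' x ∧ (M'.prod P').range = ⊤) :
    ∀ x ∈ O₀, ∀ i, Γ i (M x) x = 0 → ∃ᶠ x' in 𝓝[M ⁻¹' {M x}] x, Γ i (M x) x' ≠ 0 := by
  intro x hx i _
  obtain ⟨M', P', hM, hP, hs⟩ := hsub x hx i
  have h1 : ∃ᶠ g in map (P i) (𝓝[M ⁻¹' {M x}] x), γ i (M x) g ≠ 0 :=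
    (hγ x hx i).filter_mono (nhds_le_map_nhdsWithin_fibre_of_surj hM hP hs)
  rw [frequently_map] at h1
  refine h1.mono fun x' hx' => ?_
  rw [hΓ]
  exact hx'

/-- ★★ **THE ENGINE WITH THE PLAIN EXEMPTION FROM SUBMERSIVE COORDINATES** (`…_sharp_of_nowhereFibreFlat` + `nowhereFibreFlat_of_submersiveCoordinates`).
[cite: EvansGariepy1992, §3.4.3 Thm 2 (C¹-submersion special case)] [cite: Mityagin2015, Proposition 1] -/
theorem exists_continuousOn_density_map_of_analytic_submersion_sharp_of_submersiveCoordinates {ι : Type*} [Countable ι] (μE : Measure E)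
    [μE.IsAddHaarMeasure] (μY : Measure Y) [μY.IsAddHaarMeasure] {M : E → Y} (hMm : Measurable M) {a : E} (hMan : AnalyticAt ℝ M a)
    (hsurj : (fderiv ℝ M a).range = ⊤) {Γ : ι → Y → E → ℝ} {O₀ : Set E} (hO₀ : IsOpen O₀) (haO₀ : a ∈ O₀)
    (hΓan : ∀ i y, AnalyticOnNhd ℝ (Γ i y) O₀)
    {G : ι → Type*} [∀ i, NormedAddCommGroup (G i)] [∀ i, NormedSpace ℝ (G i)] [∀ i, CompleteSpace (G i)]
    (P : ∀ i, E → G i) (γ : ∀ i, Y → G i → ℝ) (hΓ : ∀ i y x, Γ i y x = γ i y (P i x))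
    (hγ : ∀ x ∈ O₀, ∀ i, ∃ᶠ g' in 𝓝 (P i x), γ i (M x) g' ≠ 0)
    (hsub : ∀ x ∈ O₀, ∀ i, ∃ (M' : E →L[ℝ] Y) (P' : E →L[ℝ] G i),
      HasStrictFDerivAt M M' x ∧ HasStrictFDerivAt (P i) P' x ∧ (M'.prod P').range = ⊤) :
    ∃ O : Set E, IsOpen O ∧ a ∈ O ∧ O ⊆ O₀ ∧ ∃ D : Set Y, IsOpen D ∧ M a ∈ D ∧
      ∀ r : E → ℝ, Measurable r → (∀ x, 0 ≤ r x) → (∀ x ∈ O, (∀ i, Γ i (M x) x ≠ 0) → ContinuousAt r x) →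
        (∃ C, ∀ x ∈ O, r x ≤ C) → (∀ x, x ∉ O → r x = 0) →
        ∃ I : Y → ℝ, ContinuousOn I D ∧ (∀ W, 0 ≤ I W) ∧
          ∀ A : Set Y, MeasurableSet A → A ⊆ D →
            (μE.withDensity fun x => ENNReal.ofReal (r x)) (M ⁻¹' A) = ∫⁻ W in A, ENNReal.ofReal (I W) ∂μY :=
  exists_continuousOn_density_map_of_analytic_submersion_sharp_of_nowhereFibreFlat μE μY hMm hMan hsurj hO₀ haO₀ hΓan
    (nowhereFibreFlat_of_submersiveCoordinates P γ hΓ hγ hsub)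

/-- ★★ **ANALYTIC SUBMERSION + FIBREWISE-ANALYTIC COORDINATE THRESHOLDS WITH FIBRE-PRESERVING COORDINATE SECTIONS ⇒ CONTINUOUS PUSH-FORWARD DENSITY FOR DENSITIES
CONTINUOUS OFF THE THRESHOLD SETS** — the siblings' plain exemption `∀ i, Γ i (M x) x ≠ 0`, NO transversality: `…_sharp_of_nowhereFibreFlat` with its side condition
supplied by `nowhereFibreFlat_of_coordinateSections`. [cite: EvansGariepy1992, §3.4.3 Thm 2 (C¹-submersion special case)] [cite: Mityagin2015, Proposition 1] -/
theorem exists_continuousOn_density_map_of_analytic_submersion_sharp_of_coordinateSections {ι : Type*} [Countable ι] (μE : Measure E)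
    [μE.IsAddHaarMeasure] (μY : Measure Y) [μY.IsAddHaarMeasure] {M : E → Y} (hMm : Measurable M) {a : E} (hMan : AnalyticAt ℝ M a)
    (hsurj : (fderiv ℝ M a).range = ⊤) {Γ : ι → Y → E → ℝ} {O₀ : Set E} (hO₀ : IsOpen O₀) (haO₀ : a ∈ O₀)
    (hΓan : ∀ i y, AnalyticOnNhd ℝ (Γ i y) O₀)
    {G : ι → Type*} [∀ i, TopologicalSpace (G i)] (P : ∀ i, E → G i) (γ : ∀ i, Y → G i → ℝ) (hΓ : ∀ i y x, Γ i y x = γ i y (P i x))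
    (hγ : ∀ x ∈ O₀, ∀ i, ∃ᶠ g' in 𝓝 (P i x), γ i (M x) g' ≠ 0)
    (hsec : ∀ x ∈ O₀, ∀ i, ∃ c : G i → E, Tendsto c (𝓝 (P i x)) (𝓝 x) ∧ ∀ᶠ g in 𝓝 (P i x), M (c g) = M x ∧ P i (c g) = g) :
    ∃ O : Set E, IsOpen O ∧ a ∈ O ∧ O ⊆ O₀ ∧ ∃ D : Set Y, IsOpen D ∧ M a ∈ D ∧
      ∀ r : E → ℝ, Measurable r → (∀ x, 0 ≤ r x) → (∀ x ∈ O, (∀ i, Γ i (M x) x ≠ 0) → ContinuousAt r x) →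
        (∃ C, ∀ x ∈ O, r x ≤ C) → (∀ x, x ∉ O → r x = 0) →
        ∃ I : Y → ℝ, ContinuousOn I D ∧ (∀ W, 0 ≤ I W) ∧
          ∀ A : Set Y, MeasurableSet A → A ⊆ D →
            (μE.withDensity fun x => ENNReal.ofReal (r x)) (M ⁻¹' A) = ∫⁻ W in A, ENNReal.ofReal (I W) ∂μY :=
  exists_continuousOn_density_map_of_analytic_submersion_sharp_of_nowhereFibreFlat μE μY hMm hMan hsurj hO₀ haO₀ hΓan
    (nowhereFibreFlat_of_coordinateSections P γ hΓ hγ hsec)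

end Literature.MeasureTheory.Integral.AnalyticSubmersion

end
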